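import Summits.CriticalPhenomena.PercolationContinuityZ3.Theorems.PercNearOneGluingNoHeavyLowerTailSahiTangentCylinderPairsAllOrders

/-!
# `NoHeavyLowerTail` (crux stmt-CriticalPhenomena-4575), Sahi programme: the all-orders contraction inequality for cylinder pairs with
# **TWO DOMINATED PRODUCT WEIGHTS** — top layer `Bern(q¹)`, bottom layer `Bern(q⁰)`, `q⁰ ≤ q¹` coordinatewise

Support file (Sahi cell, seat `prim-sahi-p1`, generation 50; `--supports stmt-CriticalPhenomena-4575`).  Pure proofs, NO definitions, no `sorry`,
standard axioms.

THE RESULT (`sahiE_twoCoin_cylinders_ge`).  For every `n`, finite `ι`, `q⁰ ≤ q¹ : ι → [0,1]`, `s ∈ [0,1]` and cylinder pairs `t_l ⊆ b_l`: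
`s · E_n^{Bern(q¹)}(1_{C(t_l)}) ≤ E_n^{ν}(F_l)`, where `ν` is the two-layer weight `(ε,ω) ↦ s·Bern(q¹)(ω)` on `ε = true`, `(1−s)·Bern(q⁰)(ω)` on
`ε = false`, and `F_l(ε,ω) = ε ? 1_{C(t_l)} ω : 1_{C(b_l)} ω`.  These `ν` are exactly the FKG weights on `Bool × {0,1}^ι` whose two layers are product
measures (the cube analogue of the dominated pairs `ν₀ ≼ ν₁` of the order-3 theorem `SahiTangent.sahiE_three_sections_principalBottom_ge`, gen 49); the
statement reads `ν(top) · E_n^{ν(·|top)}(A_l | top) ≤ E_n^{ν}(A_l)`.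
PROOF: DOUBLE THE CUBE.  On `ι ⊕ ι` take the single product weight `q̃ = (q¹, ρ)` with `q¹_i ρ_i = q⁰_i`, tops `t_l` in the first copy and bottoms
`b_l ⊔ b_l` in both copies; every mixed moment of this one-weight cylinder-pair family equals the corresponding moment of the two-weight family
(`M̃(B ⊔ B) = M¹(B)·M^ρ(B) = M⁰(B)`), so `sahiE_congr_of_moments` transports `sahiE_coin_cylinders_ge` (the one-weight theorem, this generation).
Nothing conjectural is asserted. [this work]
-/

namespace Summit.CriticalPhenomena.PercolationContinuityZ3.Theorems.SahiTangentCyl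

open Finset Function Literature.Combinatorics.Sahi2008
open Literature.Probability.Percolation.DecisionTree (ind ind_of_mem ind_of_not_mem ind_nonneg)
open scoped BigOperators

noncomputable section

variable {ι : Type*} [DecidableEq ι]

/-! ### Plumbing on the doubled index set `ι ⊕ ι` -/

/-- The union over `S` of first-copy images is the first-copy image of the union. [this work] -/
theorem biUnion_map_inl {n : ℕ} (A : Fin n → Finset ι) (S : Finset (Fin n)) :
    S.biUnion (fun l => (A l).map (Embedding.inl : ι ↪ ι ⊕ ι)) = (S.biUnion A).map Embedding.inl := by
  ext x
  simp only [mem_biUnion, mem_map]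
  constructor
  · rintro ⟨l, hl, a, ha, rfl⟩
    exact ⟨a, ⟨l, hl, ha⟩, rfl⟩
  · rintro ⟨a, ⟨l, hl, ha⟩, rfl⟩
    exact ⟨l, hl, a, ha, rfl⟩

/-- The union over `S` of the two-copy images is the two-copy image of the union. [this work] -/
theorem biUnion_map_inl_union_inr {n : ℕ} (A : Fin n → Finset ι) (S : Finset (Fin n)) :
    S.biUnion (fun l => (A l).map (Embedding.inl : ι ↪ ι ⊕ ι) ∪ (A l).map (Embedding.inr : ι ↪ ι ⊕ ι))
      = (S.biUnion A).map Embedding.inl ∪ (S.biUnion A).map Embedding.inr := by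
  ext x
  simp only [mem_biUnion, mem_union, mem_map]
  constructor
  · rintro ⟨l, hl, ⟨a, ha, rfl⟩ | ⟨a, ha, rfl⟩⟩
    · exact Or.inl ⟨a, ⟨l, hl, ha⟩, rfl⟩
    · exact Or.inr ⟨a, ⟨l, hl, ha⟩, rfl⟩
  · rintro (⟨a, ⟨l, hl, ha⟩, rfl⟩ | ⟨a, ⟨l, hl, ha⟩, rfl⟩)
    · exact ⟨l, hl, Or.inl ⟨a, ha, rfl⟩⟩
    · exact ⟨l, hl, Or.inr ⟨a, ha, rfl⟩⟩

omit [DecidableEq ι] in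
/-- Masses of first-copy cylinders. [this work] -/
theorem cylMass_map_inl (p r : ι → ℝ) (A : Finset ι) :
    cylMass (Sum.elim p r) (A.map (Embedding.inl : ι ↪ ι ⊕ ι)) = cylMass p A := by
  unfold cylMass; rw [Finset.prod_map]; rfl

/-- Masses of two-copy cylinders: the product of the two coordinate products. [this work] -/
theorem cylMass_map_inl_union_inr (p r : ι → ℝ) (A : Finset ι) :
    cylMass (Sum.elim p r) (A.map (Embedding.inl : ι ↪ ι ⊕ ι) ∪ A.map (Embedding.inr : ι ↪ ι ⊕ ι)) = ∏ i ∈ A, p i * r i := by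
  have hd : Disjoint (A.map (Embedding.inl : ι ↪ ι ⊕ ι)) (A.map (Embedding.inr : ι ↪ ι ⊕ ι)) := by
    rw [Finset.disjoint_left]
    intro x hx hx'
    obtain ⟨a, _, rfl⟩ := mem_map.1 hx
    obtain ⟨c, _, hc⟩ := mem_map.1 hx'
    exact Sum.inr_ne_inl hc
  rw [cylMass_union_of_disjoint hd, Finset.prod_mul_distrib]
  unfold cylMass
  rw [Finset.prod_map, Finset.prod_map]
  rfl

/-- Products of plain cylinder indicators. [this work] -/
theorem prod_cylInd {κ : Type*} [DecidableEq κ] {n : ℕ} (A : Fin n → Finset κ) (S : Finset (Fin n)) :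
    ∏ l ∈ S, (fun ω : Set κ => ind {ω : Set κ | (A l : Set κ) ⊆ ω} ω) = fun ω => ind {ω : Set κ | ((S.biUnion A : Finset κ) : Set κ) ⊆ ω} ω := by
  induction S using Finset.induction_on with
  | empty =>
    funext ω
    simp [ind_of_mem (Set.mem_univ ω)]
  | insert a s ha ih =>
    rw [Finset.prod_insert ha, ih, cylInd_mul, Finset.biUnion_insert, Finset.union_comm]

variable [Fintype ι]

omit [DecidableEq ι] in
/-- The two-layer expectation with two weights splits over the layers. [this work] -/
theorem ex_coin₂ (μ₁ μ₀ : Set ι → ℝ) (s : ℝ) (G : Bool × Set ι → ℝ) :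
    ex (fun z : Bool × Set ι => if z.1 then s * μ₁ z.2 else (1 - s) * μ₀ z.2) G
      = s * ex μ₁ (fun ω => G (true, ω)) + (1 - s) * ex μ₀ (fun ω => G (false, ω)) := by
  simp only [ex, Fintype.sum_prod_type, Fintype.sum_bool, if_true, if_false, Bool.false_eq_true, Finset.mul_sum, mul_assoc]

omit [DecidableEq ι] in
/-- **Expectation of a coin-cylinder slot under two layer weights**: `s·M¹(T) + (1−s)·K·M⁰(B)`. [this work] -/
theorem ex_cSlot₂ (q₁ q₀ : ι → unitInterval) (s : ℝ) (T B : Finset ι) (K : ℝ) :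
    ex (fun z : Bool × Set ι => if z.1 then s * bernoulliWeight q₁ z.2 else (1 - s) * bernoulliWeight q₀ z.2) (cSlot T B K)
      = s * cylMass (fun e => (q₁ e : ℝ)) T + (1 - s) * K * cylMass (fun e => (q₀ e : ℝ)) B := by
  rw [ex_coin₂]
  simp only [cSlot, if_true, Bool.false_eq_true, if_false]
  have e : (fun ω : Set ι => K * ind {ω : Set ι | (B : Set ι) ⊆ ω} ω) = K • fun ω => ind {ω : Set ι | (B : Set ι) ⊆ ω} ω := rfl
  rw [e, ex_smul, ex_ind_cyl', ex_ind_cyl']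
  ring

/-- **THE CONTRACTION INEQUALITY FOR CYLINDER PAIRS, TWO DOMINATED PRODUCT WEIGHTS, EVERY ORDER.**  For `q⁰ ≤ q¹ : ι → [0,1]`, `s ∈ [0,1]`, cylinder
pairs `t_l ⊆ b_l`:  `s · E_n^{Bern(q¹)}(1_{C(t_l)}) ≤ E_n^{ν}(F_l)` for the two-layer weight `ν(true,ω) = s·Bern(q¹)(ω)`, `ν(false,ω) = (1−s)·Bern(q⁰)(ω)`
(an FKG weight on `Bool × {0,1}^ι`; `ν(top)·E_n^{ν(·|top)}(A|top) ≤ E_n^{ν}(A)`).  Proof by doubling the cube and `sahiE_congr_of_moments`. [this work] -/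
theorem sahiE_twoCoin_cylinders_ge (q₁ q₀ : ι → unitInterval) (hq : ∀ i, (q₀ i : ℝ) ≤ q₁ i) {s : ℝ} (hs0 : 0 ≤ s) (hs1 : s ≤ 1)
    {n : ℕ} {t b : Fin n → Finset ι} (htb : ∀ l, t l ⊆ b l) :
    s * sahiE (bernoulliWeight q₁) n (fun l (ω : Set ι) => ind {ω : Set ι | (t l : Set ι) ⊆ ω} ω) ≤
      sahiE (fun z : Bool × Set ι => if z.1 then s * bernoulliWeight q₁ z.2 else (1 - s) * bernoulliWeight q₀ z.2) n
        (fun l (z : Bool × Set ι) => if z.1 then ind {ω : Set ι | (t l : Set ι) ⊆ ω} z.2 else ind {ω : Set ι | (b l : Set ι) ⊆ ω} z.2) := by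
  have hq0 : ∀ i, 0 ≤ ((q₀ i : ℝ)) := fun i => (q₀ i).2.1
  have hq1' : ∀ i, 0 ≤ ((q₁ i : ℝ)) := fun i => (q₁ i).2.1
  have hq11 : ∀ i, ((q₁ i : ℝ)) ≤ 1 := fun i => (q₁ i).2.2
  -- the ratio `ρ_i = q⁰_i / q¹_i ∈ [0,1]` (`0` when `q¹_i = 0`), with `q¹_i ρ_i = q⁰_i`
  have hρmem : ∀ i, (if (q₁ i : ℝ) = 0 then (0 : ℝ) else (q₀ i : ℝ) / q₁ i) ∈ unitInterval := by
    intro i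
    by_cases h : (q₁ i : ℝ) = 0
    · rw [if_pos h]; exact ⟨le_rfl, zero_le_one⟩
    · rw [if_neg h]
      exact ⟨div_nonneg (hq0 i) (hq1' i), div_le_one_of_le₀ (hq i) (hq1' i)⟩
  set ρ : ι → unitInterval := fun i => ⟨_, hρmem i⟩ with hρ
  have hρq : ∀ i, (q₁ i : ℝ) * (ρ i : ℝ) = q₀ i := by
    intro i
    show (q₁ i : ℝ) * (if (q₁ i : ℝ) = 0 then (0 : ℝ) else (q₀ i : ℝ) / q₁ i) = q₀ i
    by_cases h : (q₁ i : ℝ) = 0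
    · rw [if_pos h, h, zero_mul]
      exact le_antisymm (hq0 i) (h ▸ hq i)
    · rw [if_neg h, mul_div_cancel₀ _ h]
  -- the doubled cube
  set qt : ι ⊕ ι → unitInterval := Sum.elim q₁ ρ with hqt
  set tt : Fin n → Finset (ι ⊕ ι) := fun l => (t l).map Embedding.inl with htt
  set bt : Fin n → Finset (ι ⊕ ι) := fun l => (b l).map Embedding.inl ∪ (b l).map Embedding.inr with hbt
  have httb : ∀ l, tt l ⊆ bt l := fun l => (map_subset_map.2 (htb l)).trans subset_union_left
  have main := sahiE_coin_cylinders_ge qt hs0 hs1 (n := n) httb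
  have eqt : (fun e : ι ⊕ ι => (qt e : ℝ)) = Sum.elim (fun e => (q₁ e : ℝ)) (fun e => (ρ e : ℝ)) := by
    funext e; rcases e with e | e <;> rfl
  -- (1) the tops: same moments on the doubled cube
  have e1 : sahiE (bernoulliWeight qt) n (fun l (ω : Set (ι ⊕ ι)) => ind {ω : Set (ι ⊕ ι) | (tt l : Set (ι ⊕ ι)) ⊆ ω} ω)
      = sahiE (bernoulliWeight q₁) n (fun l (ω : Set ι) => ind {ω : Set ι | (t l : Set ι) ⊆ ω} ω) := by
    refine sahiE_congr_of_moments _ _ n _ _ fun S _ => ?_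
    rw [prod_cylInd, prod_cylInd, ex_ind_cyl', ex_ind_cyl', htt, biUnion_map_inl, eqt, cylMass_map_inl]
  -- (2) the pairs: same moments as the two-weight family
  have e2 : sahiE (fun z : Bool × Set (ι ⊕ ι) => if z.1 then s * bernoulliWeight qt z.2 else (1 - s) * bernoulliWeight qt z.2) n
        (fun l (z : Bool × Set (ι ⊕ ι)) => if z.1 then ind {ω : Set (ι ⊕ ι) | (tt l : Set (ι ⊕ ι)) ⊆ ω} z.2
          else ind {ω : Set (ι ⊕ ι) | (bt l : Set (ι ⊕ ι)) ⊆ ω} z.2)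
      = sahiE (fun z : Bool × Set ι => if z.1 then s * bernoulliWeight q₁ z.2 else (1 - s) * bernoulliWeight q₀ z.2) n
        (fun l (z : Bool × Set ι) => if z.1 then ind {ω : Set ι | (t l : Set ι) ⊆ ω} z.2 else ind {ω : Set ι | (b l : Set ι) ⊆ ω} z.2) := by
    have f1 : (fun l (z : Bool × Set (ι ⊕ ι)) => if z.1 then ind {ω : Set (ι ⊕ ι) | (tt l : Set (ι ⊕ ι)) ⊆ ω} z.2
          else ind {ω : Set (ι ⊕ ι) | (bt l : Set (ι ⊕ ι)) ⊆ ω} z.2) = fun l => cSlot (tt l) (bt l) ((fun _ => (1 : ℝ)) l) := by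
      funext l; exact cSlot_one_eq_pair (tt l) (bt l)
    have f2 : (fun l (z : Bool × Set ι) => if z.1 then ind {ω : Set ι | (t l : Set ι) ⊆ ω} z.2 else ind {ω : Set ι | (b l : Set ι) ⊆ ω} z.2)
        = fun l => cSlot (t l) (b l) ((fun _ => (1 : ℝ)) l) := by
      funext l; exact cSlot_one_eq_pair (t l) (b l)
    rw [f1, f2]
    refine sahiE_congr_of_moments _ _ n _ _ fun S _ => ?_
    rw [prod_cSlot, prod_cSlot, ex_cSlot, ex_cSlot₂, Finset.prod_const_one, htt, hbt, biUnion_map_inl, biUnion_map_inl_union_inr, eqt,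
      cylMass_map_inl, cylMass_map_inl_union_inr]
    have em : ∏ i ∈ S.biUnion b, (q₁ i : ℝ) * (ρ i : ℝ) = cylMass (fun e => (q₀ e : ℝ)) (S.biUnion b) := by
      unfold cylMass; exact Finset.prod_congr rfl fun i _ => hρq i
    rw [em]
  rw [e1, e2] at main
  exact main

end

end Summit.CriticalPhenomena.PercolationContinuityZ3.Theorems.SahiTangentCyl
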